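import Literature.AlgebraicGeometry.HodgeTheory.WeilClasses
import Literature.AlgebraicGeometry.HodgeTheory.ChernCharacterBetti
import Literature.AlgebraicGeometry.HodgeTheory.SemiregularityHigherSigma
import HarnessLib.Audit
import HarnessLib

/-!
# Venture HSemireg — the «Voisin barrier» for the semiregularity method, STATEMENT ONLY
# (no `h` in the Chern character ⟹ no semiregularity, on every Weil-type abelian variety)

HONEST FRAMING. Interface file of the computation cell `pub-hsemireg` (general-structure seat gs-eng-1, note
`run/shared/lean/pub/pub-hsemireg/general-structure/eng1/g9/NORM-VOISIN-gs-eng-1-g9.md` §3 «THEOREM V»). It TYPES,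
as a named `Prop` with a body and NO proof, a NEGATIVE statement about the Bloch/Buchweitz–Flenner semiregularity
METHOD: it says where the method cannot work. It makes no claim about any case of the Hodge conjecture and is not a
hypothesis of any chain in this directory; `STRUCTURE.md` of the cell cites it as a structural no-go. The seat proof
(NORM-VOISIN §3, (V0)–(V5)) assembles two PRINTED theorems — Buchweitz–Flenner 2003 Thm. 5.1 (for coherent modules,
over an arbitrary smooth ANALYTIC germ) and Voisin 2002 Thm. 1 / Appendix (Bando–Siu) — with two elementary lemmas on
the family of complex tori with `K`-multiplication; it is NOT formalised here (the tree has no carrier for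
deformations over a non-algebraic base, nor for coherent sheaves on non-algebraic tori). Proof can trail; until
then consumers must treat `VoisinBarrierHFree` as an OPEN named statement of the cell, not as a fact.

## The statement in words

Let `A` be a complex abelian variety of dimension `2n`, `n ≥ 2`, and `φ : A ⟶ A` an endomorphism with
`φ ≫ φ = -d`, `d ≥ 1` (so `K = ℚ(√-d) ↪ End⁰(A)`; NO condition on the signature, the discriminant, or
complex multiplication). Let `E` be a finite locally free `𝒪_A`-module whose Chern character is «`h`-free and
`W`-carrying»: `chₖ(E) = 0` for every `0 < k < 2n`, `k ≠ n`, and `0 ≠ chₙ(E) ∈ W_K ⊗ ℂ = weilClassesOf A φ n d`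
(van Geemen's plane of Weil classes, `WeilClasses.lean`). Then for NO set `I` of form degrees is `E`
`I`-semiregular in the sense of Buchweitz–Flenner (`IsISemiregular`, `SemiregularityHigherSigma.lean`): the
partial semiregularity maps `(σ_q)_{q ∈ I} : Ext²(E, E) → ∏ H^{q+2}(A, Ωᵠ)` are never jointly injective (for
`I = ∅`: `Ext²(E, E) ≠ 0`).

Why (seat proof, one paragraph): such a character stays of Hodge type on EVERY complex torus with `K`-action of
type `(n, n)` near `A` (a smooth `2n²`-dimensional analytic germ `S`, mostly non-projective); BF03 Thm. 5.1, whose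
printed proof runs over any smooth analytic germ, propagates an `I`-semiregular `E` to a coherent `S`-flat sheaf on
the family, hence to a coherent sheaf with a non-zero Weil Chern class on a very general `K`-torus; but there the
Hodge classes are `ℚ·1 ⊕ W_K ⊕ ℚ·[pt]` only (generic Mumford–Tate group `⊇ Res_{K/ℚ} SL_{2n}`), there is no
positive-dimensional proper analytic subvariety, and Voisin 2002 (Prop. 1 for `n = 2`; Appendix Thm. 2 = Bando–Siu,
Prop. 4, Cor. 1 for `n ≥ 3`) gives `ch(F) ∈ ℚ·1 ⊕ ℚ·[pt]` for every coherent sheaf `F` — contradiction. The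
hypothesis «signature `(n, n)`» is automatic: `chₙ(E)` is a non-zero rational Hodge class in `W_K`.

## Rendering and scope

* `A : Motives.AbelianVariety ℂ`, `φ : A ⟶ A`, `φ ≫ φ = -(d • 𝟙 A)` — exactly the binders of `WeilClasses.lean`
  and `WeilTypePeriodPoint.lean`; `A.dim = 2 * n`.
* `E : A.X.left.Modules` finite locally free (`Motives.IsFiniteLocallyFree`) — the tree's `σ_q` / `IsISemiregular`
  need a locally free `E`; the seat theorem covers every COHERENT sheaf (BF03 Thm. 5.1 is printed for modules), so
  this rendering is the locally-free special case. Perfect complexes that are not sheaves are NOT covered by the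
  seat proof either (hypothesis (H-cx) of the note).
* Chern character: a Chern character theory `C : ChernCharacterBetti` (hypothesis structure of the tree, quantified
  universally, as in `BuchweitzFlenner2003_variationalHodge_ISemiregular`); «`h`-free» = the vanishing of `C.ch` in
  all degrees `0 < k < 2n` other than `n` (degrees `0` and `2n` are the rank and a multiple of the point class);
  «`W`-carrying» = `C.ch A.X E n ∈ weilClassesOf A φ n d` and `≠ 0`.
* `I : Set ℕ` of FORM degrees `q` (BF index by the Chern degree `p = q + 1`; all `I` are excluded, so the indexing
  convention is immaterial).

## Sources

* [BuchweitzFlenner2003] R.-O. Buchweitz, H. Flenner, *A semiregularity map for modules and applications to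
  deformations*, Compositio Math. 137 (2003) 135–210: Def. 4.1 p. 166; §5 «`I`-semiregular» p. 174; Thm. 5.1
  p. 174 l. 56 – p. 175 l. 4 and its proof p. 179 l. 22–38 («`F := (1×φ)^*(E)` is a coherent `S`-flat module on `X`
  that induces `E₀` on the special fibre»).
* [Voisin2002KaehlerCounterexample] C. Voisin, *A counterexample to the Hodge conjecture extended to Kähler varieties*, IMRN 2002
  no. 20, 1057–1075 (arXiv:math/0112247): Thm. 1 and §2 Prop. 1 (dimension 4: `c₂(F) = 0` for every coherent `F`
  under (a) `NS = 0`, (b) no positive-dimensional proper analytic subset, (c) `Hdg⁴ ⊥ [ω]²`); Appendix Thm. 2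
  (Bando–Siu), Prop. 4, Cor. 1 (under «`Hdg² = 0` and `Hdg⁴ ⊥ [ω]^{dim-2}`»: every torsion-free `F ↪ E` with all
  rational `cᵢ(E) = 0` and torsion cokernel).
* [vanGeemen1994HodgeAV] B. van Geemen, *An introduction to the Hodge conjecture for abelian varieties*, 4.9, 5.2,
  6.12 (the plane `W_K`).
-/

noncomputable section

open CategoryTheory AlgebraicGeometry
open Literature.AlgebraicGeometry Literature.AlgebraicGeometry.HodgeTheory

namespace Summit.Ventures.HSemireg


/-- **The Voisin barrier (THEOREM V of the cell note NORM-VOISIN §3), `h`-free form — STATEMENT.** For every Chern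
character theory `C`, every complex abelian variety `A` of dimension `2n` (`n ≥ 2`) with an endomorphism `φ`,
`φ ≫ φ = -d` (`d ≥ 1`), and every finite locally free `E` on `A` with `chₖ(E) = 0` for `0 < k < 2n`, `k ≠ n`, and
`0 ≠ chₙ(E) ∈ weilClassesOf A φ n d` (the complexified plane of Weil classes of `(A, ℚ(√-d))`), the sheaf `E` is
`I`-semiregular for NO set `I` of form degrees: no part `(σ_q)_{q ∈ I}` of the Buchweitz–Flenner semiregularity map
`Ext²(E, E) → ∏_q H^{q+2}(A, Ωᵠ)` is injective. Seat-derived from [BuchweitzFlenner2003, Thm. 5.1 and its proof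
p. 179] over the analytic germ of complex tori with `K`-action and [Voisin2002KaehlerCounterexample, Thm. 1, §2 Prop. 1, Appendix
Thm. 2 / Prop. 4 / Cor. 1]; NOT proved in the tree (typed so that the cell's structure file can cite one name;
consumers must carry it as an open statement). The printed inputs cover coherent `E`; this rendering is the
locally free case, the only one the tree's `σ_q` can express. Tagged `@[conjecture]`: an obligation node of the
cell, closed by a future `theorem … : VoisinBarrierHFree` (or refuted by name). [status: open — seat-derived 2026-08-22, proof
not formalised] [cite: BuchweitzFlenner2003, Thm. 5.1 and §5 (I-semiregular)] [cite: Voisin2002KaehlerCounterexample, Thm. 1 and Appendix Prop. 4]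
[cite: vanGeemen1994HodgeAV, 4.9] -/
@[conjecture] def VoisinBarrierHFree : Prop :=
  ∀ (C : ChernCharacterBetti) (A : Motives.AbelianVariety ℂ) (φ : A ⟶ A) (n d : ℕ),
    2 ≤ n → A.dim = 2 * n → 0 < d → φ ≫ φ = -(d • 𝟙 A) →
    ∀ (E : A.X.left.Modules) (hE : Motives.IsFiniteLocallyFree E),
      (∀ k : ℕ, 0 < k → k < 2 * n → k ≠ n → C.ch A.X E k = 0) →
      C.ch A.X E n ∈ weilClassesOf A φ n d →
      C.ch A.X E n ≠ 0 →
      ∀ I : Set ℕ, ¬ IsISemiregular hE I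

/-- **Unfolding for consumers**: under `VoisinBarrierHFree`, an `h`-free `W`-carrying finite locally free `E` on a
`2n`-dimensional abelian variety with `φ ≫ φ = -d` has, for every `I`, a non-zero `x ∈ Ext²(E, E)` killed by all
`σ_q`, `q ∈ I` (the literal negation of `IsISemiregular`). [cite: BuchweitzFlenner2003, §5 (I-semiregular)] -/
theorem VoisinBarrierHFree.exists_ne_zero_of_hFree (hV : VoisinBarrierHFree) (C : ChernCharacterBetti)
    (A : Motives.AbelianVariety ℂ) (φ : A ⟶ A) (n d : ℕ) (hn : 2 ≤ n) (hA : A.dim = 2 * n) (hd : 0 < d)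
    (hφ : φ ≫ φ = -(d • 𝟙 A)) (E : A.X.left.Modules) (hE : Motives.IsFiniteLocallyFree E)
    (hfree : ∀ k : ℕ, 0 < k → k < 2 * n → k ≠ n → C.ch A.X E k = 0)
    (hW : C.ch A.X E n ∈ weilClassesOf A φ n d) (hne : C.ch A.X E n ≠ 0) (I : Set ℕ) :
    ∃ x : Abelian.Ext E E 2, (∀ q ∈ I, sigmaHigher hE q x = 0) ∧ x ≠ 0 := by
  have h := hV C A φ n d hn hA hd hφ E hE hfree hW hne I
  unfold IsISemiregular at h
  push Not at h
  exact h

/-- **In particular no such `E` is semiregular in the full sense** (`I = Set.univ`: the whole semiregularity map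
`(σ_q)_q` is not injective) — the form in which the cell's census speaks of «σ injective».
[cite: BuchweitzFlenner2003, Def. 4.1 and §5] -/
theorem VoisinBarrierHFree.not_isISemiregular_univ (hV : VoisinBarrierHFree) (C : ChernCharacterBetti)
    (A : Motives.AbelianVariety ℂ) (φ : A ⟶ A) (n d : ℕ) (hn : 2 ≤ n) (hA : A.dim = 2 * n) (hd : 0 < d)
    (hφ : φ ≫ φ = -(d • 𝟙 A)) (E : A.X.left.Modules) (hE : Motives.IsFiniteLocallyFree E)
    (hfree : ∀ k : ℕ, 0 < k → k < 2 * n → k ≠ n → C.ch A.X E k = 0)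
    (hW : C.ch A.X E n ∈ weilClassesOf A φ n d) (hne : C.ch A.X E n ≠ 0) :
    ¬ IsISemiregular hE Set.univ :=
  hV C A φ n d hn hA hd hφ E hE hfree hW hne Set.univ

end Summit.Ventures.HSemireg

end
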